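import Summits.HubbardSuperconductivity.HubbardSuperconductivity.Theorems.AnisotropyChordTransferSectorZeroGraph
import Summits.HubbardSuperconductivity.HubbardSuperconductivity.Theorems.AnisotropyChordTransferTwoBlock
import Summits.HubbardSuperconductivity.HubbardSuperconductivity.Theorems.AnisotropyChordEnergyConvexAllGraphs

/-!
# Route `AnisotropyChord` / H0 rotor rung, route (1): THEOREM L1 on GENERAL GRAPHS — the original-frame package
# (the flip operator `⨂σˣ`, `E(−M) = E(M)`, a flip-symmetric sector-`0` ground vector, sector eigenvectors)

Ingredients for the general-graph form `SectorOneBelowHigherGraph` of the theory seat's THEOREM L1 (g12, THEOREM-L1.md, PartF.lean), for the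
spin-½ XXZ ferromagnet `H(Δ) = xxzHamiltonian 1 G (−1) Δ` on a finite graph:

* the GLOBAL FLIP as the product operator `F = ⨂σˣ` (`flipXOp_*`): unitary and Hermitian, `F S^b F = ±S^b`, hence `F H(Δ) F = H(Δ)`
  (`flipXOp_conj_xxz`) and `F Sᶻ_tot F = −Sᶻ_tot`; `F` maps `𝓗_M` onto `𝓗_{−M}` and `E(−M) = E(M)` (`lowestEnergyInSector_neg_eq`);
* `exists_flipSymmetric_sectorZero_ground`: on `2m` vertices the sector `0` carries a non-zero, entrywise non-negative, FLIP-INVARIANT eigenvector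
  at `E(0)` (symmetrise the non-negative sector ground vector of the tree's `xxz_exists_nonneg_sectorGroundState`);
* `exists_sector_eigenvector_flip_disjoint`: a non-empty sector `M ≠ 0` carries a unit eigenvector at `E(M)` whose support is disjoint from
  that of its flip.

All folklore.  Prover seat `hubbard-h0-rotor-p1` g14.
-/

set_option linter.dupNamespace false
set_option autoImplicit false

noncomputable section

open Finset Matrix
open scoped ComplexOrder
open Literature.MathematicalPhysics.QuantumLattice Literature.MathematicalPhysics.QuantumLattice.SpinOperators

namespace Summit.HubbardSuperconductivity.HubbardSuperconductivity.Theorems.AnisotropyChord.Transfer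

section FlipX

variable {Λ : Type*} [Fintype Λ] [DecidableEq Λ] (G : SimpleGraph Λ) [DecidableRel G.Adj]

/-- `σˣ σˣ = 1`. [folklore] -/
theorem pauliX_mul_pauliX : spinHalfPauli 0 * spinHalfPauli 0 = 1 := by
  ext i j
  fin_cases i <;> fin_cases j <;> simp [spinHalfPauli, Matrix.mul_apply, Fin.sum_univ_two]

/-- `σˣ` is Hermitian. [folklore] -/
theorem pauliX_conjTranspose : (spinHalfPauli 0)ᴴ = spinHalfPauli 0 := by
  ext i j
  fin_cases i <;> fin_cases j <;> simp [spinHalfPauli, Matrix.conjTranspose_apply]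

/-- conjugation of the spin-½ spin vector by `σˣ`: `σˣ Sˣ σˣ = Sˣ`, `σˣ Sʸ σˣ = −Sʸ`, `σˣ Sᶻ σˣ = −Sᶻ`. [folklore] -/
theorem pauliX_conj_spinVec (b : Fin 3) :
    spinHalfPauli 0 * spinVec 1 b * (spinHalfPauli 0)ᴴ = (if b = 0 then (1 : ℂ) else -1) • spinVec 1 b := by
  rw [pauliX_conjTranspose, spinVec_one_eq_half_spinHalfPauli]
  fin_cases b <;>
  · ext i j
    fin_cases i <;> fin_cases j <;>
      simp [spinHalfPauli, Matrix.mul_apply, Fin.sum_univ_two]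

/-- `⨂σˣ` is unitary and Hermitian. [folklore] -/
theorem flipXOp_unitary :
    productOp (fun _ : Λ => spinHalfPauli 0) * (productOp (fun _ : Λ => spinHalfPauli 0))ᴴ = 1 ∧
    (productOp (fun _ : Λ => spinHalfPauli 0))ᴴ * productOp (fun _ : Λ => spinHalfPauli 0) = 1 ∧
    (productOp (fun _ : Λ => spinHalfPauli 0))ᴴ = productOp (fun _ : Λ => spinHalfPauli 0) := by
  have hu : ∀ _x : Λ, spinHalfPauli 0 * (spinHalfPauli 0)ᴴ = 1 := fun _ => by rw [pauliX_conjTranspose, pauliX_mul_pauliX]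
  have hu' : ∀ _x : Λ, (spinHalfPauli 0)ᴴ * spinHalfPauli 0 = 1 := fun _ => by rw [pauliX_conjTranspose, pauliX_mul_pauliX]
  refine ⟨productOp_mul_conjTranspose hu, productOp_conjTranspose_mul hu', ?_⟩
  rw [productOp_conjTranspose]
  simp only [pauliX_conjTranspose]

/-- **`⨂σˣ` fixes every bond `S^b_x S^b_y`.** [folklore] -/
theorem flipXOp_conj_spinBond (b : Fin 3) (x y : Λ) :
    productOp (fun _ : Λ => spinHalfPauli 0) * spinBond 1 b x y * (productOp (fun _ : Λ => spinHalfPauli 0))ᴴ = spinBond 1 b x y := by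
  have hu : ∀ _x : Λ, spinHalfPauli 0 * (spinHalfPauli 0)ᴴ = 1 := fun _ => by rw [pauliX_conjTranspose, pauliX_mul_pauliX]
  have hu' : ∀ _x : Λ, (spinHalfPauli 0)ᴴ * spinHalfPauli 0 = 1 := fun _ => by rw [pauliX_conjTranspose, pauliX_mul_pauliX]
  rw [productOp_conj_spinBond_of_smul (n := 1) hu hu' (f := fun _ : Λ => if b = 0 then (1 : ℂ) else -1)
    (fun _ => pauliX_conj_spinVec b) x y]
  split_ifs <;> simp

/-- **`⨂σˣ` commutes with the XXZ Hamiltonian** (π-rotation of all spins about the `x` axis). [folklore] -/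
theorem flipXOp_conj_xxz (Δ : ℝ) :
    productOp (fun _ : Λ => spinHalfPauli 0) * xxzHamiltonian 1 G (-1) Δ * (productOp (fun _ : Λ => spinHalfPauli 0))ᴴ =
      xxzHamiltonian 1 G (-1) Δ := by
  set U := productOp (fun _ : Λ => spinHalfPauli 0) with hU
  rw [xxzHamiltonian_eq_xyzBondHamiltonianOn, xyzBondHamiltonianOn, mul_neg, neg_mul, Finset.mul_sum, Finset.sum_mul]
  congr 1
  refine Finset.sum_congr rfl fun e _ => ?_
  induction e using Sym2.ind with
  | h x y =>
    rw [Sym2.lift_mk]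
    show U * xyzBond₃ 1 1 1 Δ x y * Uᴴ = xyzBond₃ 1 1 1 Δ x y
    rw [xyzBond₃, mul_add, mul_add, add_mul, add_mul, mul_smul_comm, mul_smul_comm, mul_smul_comm,
      smul_mul_assoc, smul_mul_assoc, smul_mul_assoc, hU, flipXOp_conj_spinBond, flipXOp_conj_spinBond,
      flipXOp_conj_spinBond]

/-- **`⨂σˣ` reverses `Sᶻ_tot`.** [folklore] -/
theorem flipXOp_conj_totalSpin_two :
    productOp (fun _ : Λ => spinHalfPauli 0) * (totalSpin 1 2 : Op Λ 2) * (productOp (fun _ : Λ => spinHalfPauli 0))ᴴ =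
      -(totalSpin 1 2 : Op Λ 2) := by
  have hu : ∀ _x : Λ, spinHalfPauli 0 * (spinHalfPauli 0)ᴴ = 1 := fun _ => by rw [pauliX_conjTranspose, pauliX_mul_pauliX]
  rw [totalSpin, Finset.mul_sum, Finset.sum_mul, ← Finset.sum_neg_distrib]
  refine Finset.sum_congr rfl fun x _ => ?_
  rw [productOp_conj_siteSpin hu x 2, pauliX_conj_spinVec, if_neg (by decide), neg_one_smul, onSite_neg', siteSpin]

/-- `H(Δ)` commutes with `⨂σˣ` on vectors. [folklore] -/
theorem xxz_mulVec_flipXOp (Δ : ℝ) (v : TensorIndex Λ 2 → ℂ) :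
    xxzHamiltonian 1 G (-1) Δ *ᵥ (productOp (fun _ : Λ => spinHalfPauli 0) *ᵥ v) =
      productOp (fun _ : Λ => spinHalfPauli 0) *ᵥ (xxzHamiltonian 1 G (-1) Δ *ᵥ v) := by
  obtain ⟨hF, hF', -⟩ := flipXOp_unitary (Λ := Λ)
  have h := flipXOp_conj_xxz G Δ
  have hcomm : xxzHamiltonian 1 G (-1) Δ * productOp (fun _ : Λ => spinHalfPauli 0) =
      productOp (fun _ : Λ => spinHalfPauli 0) * xxzHamiltonian 1 G (-1) Δ := by
    calc xxzHamiltonian 1 G (-1) Δ * productOp (fun _ : Λ => spinHalfPauli 0)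
        = productOp (fun _ : Λ => spinHalfPauli 0) * xxzHamiltonian 1 G (-1) Δ * (productOp (fun _ : Λ => spinHalfPauli 0))ᴴ *
            productOp (fun _ : Λ => spinHalfPauli 0) := by rw [h]
      _ = productOp (fun _ : Λ => spinHalfPauli 0) * xxzHamiltonian 1 G (-1) Δ := by rw [Matrix.mul_assoc, hF', Matrix.mul_one]
  rw [Matrix.mulVec_mulVec, Matrix.mulVec_mulVec, hcomm]

/-- `⨂σˣ` maps `𝓗_M` into `𝓗_{−M}`. [folklore] -/
theorem flipXOp_mulVec_mem {M : ℝ} {v : TensorIndex Λ 2 → ℂ} (hv : v ∈ spinZSector (Λ := Λ) 1 M) :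
    productOp (fun _ : Λ => spinHalfPauli 0) *ᵥ v ∈ spinZSector (Λ := Λ) 1 (-M) := by
  obtain ⟨-, hF', hFh⟩ := flipXOp_unitary (Λ := Λ)
  set F : Op Λ 2 := productOp (fun _ : Λ => spinHalfPauli 0) with hFdef
  have hFF : F * F = 1 := by have := hF'; rwa [hFh] at this
  have h := flipXOp_conj_totalSpin_two (Λ := Λ)
  rw [← hFdef, hFh] at h
  have hanti : (totalSpin 1 2 : Op Λ 2) * F = -(F * (totalSpin 1 2 : Op Λ 2)) := by
    calc (totalSpin 1 2 : Op Λ 2) * F = (F * F) * totalSpin 1 2 * F := by rw [hFF, Matrix.one_mul]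
      _ = F * (F * totalSpin 1 2 * F) := by simp only [Matrix.mul_assoc]
      _ = -(F * (totalSpin 1 2 : Op Λ 2)) := by rw [h, Matrix.mul_neg]
  rw [spinZSector, Module.End.mem_eigenspace_iff, Matrix.toLin'_apply] at hv ⊢
  rw [Matrix.mulVec_mulVec, hanti, Matrix.neg_mulVec, ← Matrix.mulVec_mulVec, hv, Matrix.mulVec_smul, ← neg_smul,
    Complex.ofReal_neg]

/-- **`E(−M) = E(M)`** for `H(Δ)` on any finite graph (the flip `⨂σˣ` is a norm- and energy-preserving bijection `𝓗_M → 𝓗_{−M}`). [folklore] -/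
theorem lowestEnergyInSector_neg_eq (Δ M : ℝ) :
    lowestEnergyInSector 1 (xxzHamiltonian 1 G (-1) Δ) (-M) = lowestEnergyInSector 1 (xxzHamiltonian 1 G (-1) Δ) M := by
  obtain ⟨hF, hF', hFh⟩ := flipXOp_unitary (Λ := Λ)
  set F : Op Λ 2 := productOp (fun _ : Λ => spinHalfPauli 0) with hFdef
  set H : Op Λ 2 := xxzHamiltonian 1 G (-1) Δ with hHdef
  have hnorm : ∀ v : TensorIndex Λ 2 → ℂ, star (F *ᵥ v) ⬝ᵥ (F *ᵥ v) = star v ⬝ᵥ v := by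
    intro v
    have h := star_dotProduct_conjTranspose_mulVec (U := F) hF v
    rwa [hFh] at h
  have hener : ∀ v : TensorIndex Λ 2 → ℂ, star (F *ᵥ v) ⬝ᵥ H *ᵥ (F *ᵥ v) = star v ⬝ᵥ H *ᵥ v := by
    intro v
    rw [hHdef, xxz_mulVec_flipXOp, Matrix.star_mulVec, ← Matrix.dotProduct_mulVec, Matrix.mulVec_mulVec, hF',
      Matrix.one_mulVec]
  have hFF : ∀ v : TensorIndex Λ 2 → ℂ, F *ᵥ (F *ᵥ v) = v := fun v => by
    rw [Matrix.mulVec_mulVec, (by rwa [hFh] at hF' : F * F = 1), Matrix.one_mulVec]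
  -- the Rayleigh sets coincide
  have key : ∀ M' : ℝ, {E : ℝ | ∃ ψ ∈ spinZSector (Λ := Λ) 1 (-M'), star ψ ⬝ᵥ ψ = 1 ∧ E = (star ψ ⬝ᵥ H *ᵥ ψ).re} ⊆
      {E : ℝ | ∃ ψ ∈ spinZSector (Λ := Λ) 1 M', star ψ ⬝ᵥ ψ = 1 ∧ E = (star ψ ⬝ᵥ H *ᵥ ψ).re} := by
    intro M' E hE
    obtain ⟨ψ, hψK, hψ1, rfl⟩ := hE
    refine ⟨F *ᵥ ψ, ?_, by rw [hnorm, hψ1], by rw [hener]⟩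
    have := flipXOp_mulVec_mem (M := -M') hψK
    rwa [neg_neg] at this
  unfold lowestEnergyInSector Matrix.minEnergyOn
  congr 1
  refine Set.Subset.antisymm (key M) ?_
  have := key (-M)
  rwa [neg_neg] at this

/-- a configuration of prescribed weight `W ≤ |Λ|`. [folklore] -/
theorem exists_config_weight (W : ℕ) (hW : W ≤ Fintype.card Λ) : ∃ σ : TensorIndex Λ 2, (∑ z, (σ z : ℕ)) = W := by
  obtain ⟨S, -, hS⟩ := Finset.exists_subset_card_eq (s := (Finset.univ : Finset Λ)) (n := W) (by rwa [Finset.card_univ])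
  refine ⟨fun z => if z ∈ S then 1 else 0, ?_⟩
  have hz : ∀ z : Λ, (((if z ∈ S then (1 : Fin 2) else 0 : Fin 2) : ℕ)) = if z ∈ S then 1 else 0 := fun z => by
    split_ifs <;> rfl
  calc (∑ z : Λ, (((if z ∈ S then (1 : Fin 2) else 0 : Fin 2) : ℕ))) = ∑ z : Λ, (if z ∈ S then 1 else 0 : ℕ) :=
        Finset.sum_congr rfl fun z _ => hz z
    _ = ∑ z ∈ S, 1 := by rw [Finset.sum_ite_mem, Finset.univ_inter]
    _ = W := by rw [Finset.sum_const, smul_eq_mul, mul_one, hS]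

omit [DecidableRel G.Adj] in
/-- **a flip-symmetric, non-negative sector-`0` eigenvector at `E(0)`** on `2m` vertices. [folklore] -/
theorem exists_flipSymmetric_sectorZero_ground [DecidableRel G.Adj] {m : ℕ} (hm : Fintype.card Λ = 2 * m) (Δ : ℝ) :
    ∃ ψ : TensorIndex Λ 2 → ℂ, ψ ≠ 0 ∧ (∀ σ, 0 ≤ (ψ σ).re ∧ (ψ σ).im = 0) ∧
      ψ ∈ spinZSector (Λ := Λ) 1 (0 : ℝ) ∧
      xxzHamiltonian 1 G (-1) Δ *ᵥ ψ = ((lowestEnergyInSector 1 (xxzHamiltonian 1 G (-1) Δ) 0 : ℝ) : ℂ) • ψ ∧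
      productOp (fun _ : Λ => spinHalfPauli 0) *ᵥ ψ = ψ := by
  obtain ⟨σ₀, hσ₀⟩ := exists_config_weight (Λ := Λ) m (by rw [hm]; omega)
  obtain ⟨ψ, hψ0, hψnn, hψK, hHψ⟩ := xxz_exists_nonneg_sectorGroundState G Δ m ⟨σ₀, hσ₀⟩
  have h0 : (((Fintype.card Λ * 1 : ℕ) : ℝ) / 2 - (m : ℝ)) = 0 := by rw [hm]; push_cast; ring
  rw [h0] at hψK hHψ
  set F : Op Λ 2 := productOp (fun _ : Λ => spinHalfPauli 0) with hFdef
  obtain ⟨hF, hF', hFh⟩ := flipXOp_unitary (Λ := Λ)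
  have hFF : F *ᵥ (F *ᵥ ψ) = ψ := by
    rw [Matrix.mulVec_mulVec, (by rwa [hFh] at hF' : F * F = 1), Matrix.one_mulVec]
  have hFψ_apply : ∀ σ, (F *ᵥ ψ) σ = ψ (fun z => 1 - σ z) := fun σ => flipXOp_mulVec ψ σ
  refine ⟨ψ + F *ᵥ ψ, ?_, ?_, ?_, ?_, ?_⟩
  · obtain ⟨σ₁, hσ₁⟩ := Function.ne_iff.1 hψ0
    have hpos : 0 < (ψ σ₁).re := by
      rcases (hψnn σ₁).1.lt_or_eq with h | h
      · exact h
      · exfalso; apply hσ₁; exact Complex.ext (by rw [← h]; rfl) (by rw [(hψnn σ₁).2]; rfl)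
    intro h
    have h1 := congrFun h σ₁
    rw [Pi.add_apply, Pi.zero_apply, hFψ_apply] at h1
    have h2 := congrArg Complex.re h1
    rw [Complex.add_re, Complex.zero_re] at h2
    linarith [(hψnn (fun z => 1 - σ₁ z)).1]
  · intro σ
    rw [Pi.add_apply, hFψ_apply, Complex.add_re, Complex.add_im, (hψnn σ).2, (hψnn _).2, add_zero]
    exact ⟨add_nonneg (hψnn σ).1 (hψnn _).1, rfl⟩
  · have h := flipXOp_mulVec_mem (M := 0) hψK
    rw [neg_zero] at h
    exact (spinZSector (Λ := Λ) 1 (0 : ℝ)).add_mem hψK h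
  · rw [Matrix.mulVec_add, xxz_mulVec_flipXOp, hHψ, Matrix.mulVec_smul, smul_add]
  · rw [Matrix.mulVec_add, hFF, add_comm]

/-- support of a sector vector: weight `W`. [folklore] -/
theorem apply_eq_zero_of_mem_sector_of_weight_ne {W : ℕ} {v : TensorIndex Λ 2 → ℂ}
    (hv : v ∈ spinZSector (Λ := Λ) 1 (((Fintype.card Λ * 1 : ℕ) : ℝ) / 2 - W)) {σ : TensorIndex Λ 2} (hσ : (∑ z, (σ z : ℕ)) ≠ W) :
    v σ = 0 :=
  (LiebMattis.mem_spinZSector_weight_iff 1 W v).1 hv σ hσ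

omit [DecidableRel G.Adj] in
/-- **a unit eigenvector at `E(M)` in a non-empty sector `M ≠ 0`, with support disjoint from its flip**, on `2m` vertices. [folklore] -/
theorem exists_sector_eigenvector_flip_disjoint [DecidableRel G.Adj] {m : ℕ} (hm : Fintype.card Λ = 2 * m) (Δ : ℝ) {M : ℝ}
    (hM : spinZSector (Λ := Λ) 1 M ≠ ⊥) (hM0 : M ≠ 0) :
    ∃ ψ : TensorIndex Λ 2 → ℂ, ψ ∈ spinZSector (Λ := Λ) 1 M ∧ star ψ ⬝ᵥ ψ = 1 ∧
      xxzHamiltonian 1 G (-1) Δ *ᵥ ψ = ((lowestEnergyInSector 1 (xxzHamiltonian 1 G (-1) Δ) M : ℝ) : ℂ) • ψ ∧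
      ∀ σ, ψ σ * ψ (fun z => 1 - σ z) = 0 := by
  set H : Op Λ 2 := xxzHamiltonian 1 G (-1) Δ with hHdef
  have hH : H.IsHermitian := xxzHamiltonian_isHermitian 1 G (-1) Δ
  have hcomm := (HardCoreBoson.commute_xxzHamiltonian_totalSpin_two 1 G (-1) Δ).eq
  have hinv : ∀ v ∈ spinZSector (Λ := Λ) 1 M, H *ᵥ v ∈ spinZSector (Λ := Λ) 1 M := by
    intro v hv
    rw [spinZSector, Module.End.mem_eigenspace_iff, Matrix.toLin'_apply] at hv ⊢
    rw [Matrix.mulVec_mulVec, ← hcomm, ← Matrix.mulVec_mulVec, hv, Matrix.mulVec_smul]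
  obtain ⟨ψ, hψK, hψ1, hHψ⟩ := exists_unit_eigen_minEnergyOn hH (spinZSector (Λ := Λ) 1 M) hinv hM
  obtain ⟨W, -, hMW⟩ := exists_weight_of_sector_ne_bot hM
  refine ⟨ψ, hψK, hψ1, hHψ, fun σ => ?_⟩
  rw [hMW] at hψK
  by_cases hσ : (∑ z, (σ z : ℕ)) = W
  · have hflip : (∑ z, (((1 : Fin 2) - σ z : Fin 2) : ℕ)) ≠ W := by
      have h := weight_flipAll_add σ
      intro h'
      apply hM0
      rw [hMW, hm]; push_cast
      have : (W : ℝ) + W = 2 * m := by exact_mod_cast (by omega : W + W = 2 * m)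
      linarith
    rw [apply_eq_zero_of_mem_sector_of_weight_ne hψK hflip, mul_zero]
  · rw [apply_eq_zero_of_mem_sector_of_weight_ne hψK hσ, zero_mul]

end FlipX

end Summit.HubbardSuperconductivity.HubbardSuperconductivity.Theorems.AnisotropyChord.Transfer
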